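import Summits.QuantumFields.BalabanUV.Beta.FP.TowerHN2Row
import Summits.QuantumFields.BalabanUV.Beta.FP.WoundEvenFamilyParities

/-!
# `BalabanUV.Beta.FP.TowerH2Letters` — road «FP», binder row D1, ROUTE T (β1), v6 BRIDGE (B4)(B4′) of `g46/SPEC-58.md`: **THE END WRAPPER's ORDER-2 H-SIDE LETTERS
# `hH₂l ∕ hH₂r ∕ hH₂t` AND THE SYMMETRISED DISPLAY `hH₂` OF PART 2 ARE THEOREMS OF ONE PIN** — the v6 display (SPEC-57 §4 (i), an2 PART 24's currency)
# `hH₂f : H₂f v v′ = (−2c)² • Σ_bΣ_{b′} (hv v b·hv v′ b′) • T̂₂ b b′ + cM₂ • Σ_bΣ_β (hv v b·hm v′ β + hv v′ b·hm v β) • ℳ̂₂ b β` over PART 2's table letter `hT₂` (the pair-symmetrised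
# `ff` block of the wound EVEN Wilson bi-stencil), PART 3a's `hm ∕ hml` and `hM₂` (the wound EVEN mixed table) and the nested column's linearity `hhvl`

WHY.  v5 (`FP/StepRecursionFeedNestedNamedD`) takes `H₂f` free with three shape letters `hH₂l hH₂r` (bilinear) and `hH₂t` (`(H₂f v v)ᵀ = H₂f v v`) and the row `hHN₂`; PART 2 ∕ 3b
read the row at the DISPLAY `hH₂ : ½•(H₂f v v′ + H₂f v′ v) = (−2c)²•ΣΣ hv hv′•T̂₂ + Λ₂ v v′`.  v6 (SPEC-58) PINS `H₂f` by `hH₂f`; then: `T̂₂` is pair-symmetric (`hT₂`'s two summands,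
`add_comm`), so `H₂f` is symmetric in its two slots and `hH₂` holds with `Λ₂ := the mixed sector` (B4′); bilinearity is `hhvl ∕ hml` under finite sums (B4); and each table
`T̂₂ b b′`, `ℳ̂₂ b β` is a symmetric MATRIX on the `ff` block because its kernel is graded-even (GAN24 `parityEven_evenHalf` through `WoundEvenFamilyParities.parityEven_tsum` and
`perF_dper_symm_ff_of_parityEven`), whence `hH₂t`.
WHAT ([folklore] `Matrix`∕`Finset` bookkeeping BY NAME; no `def`, no `def … : Prop`, nothing cited, 0 sorry; letters VERBATIM from PART 2 ∕ 3a + the pin `hH₂f`):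
§1 generic bilinear-form algebra (`sum_sum_mul_smul_linear_left ∕ _right`, `sum_sum_pair_smul_linear_left ∕ _right`); §2 `T₂_pair_symm`, `T₂_transpose`, `M₂_transpose`
(parity); §3 **`H2f_symm`**, **`H2f_half_symm_eq`** (v5∕PART 2's `hH₂` with `Λ₂ v v′ := cM₂ • ΣΣ (hv v b·hm v′ β + hv v′ b·hm v β) • ℳ̂₂ b β`), **`H2f_linear_left ∕ H2f_linear_right`**
(v5's `hH₂l ∕ hH₂r`), **`H2f_transpose`** (v5's `hH₂t`).
WHAT THIS IS NOT: not the pin's inhabitation (the (C1) instantiation's Hessian-table word); not v6; not `a2`; nothing of Bałaban's asserted, valued or discharged; 0 estimates;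
0∕4 row-D1 binders (hW, hR, D1Tel, D1Rep); ROOT M‴ p325680 ∕ P5c ∕ D6 untouched; NOT (C1), NOT (T-ID), NOT D1, NEVER «G-an2-4 closed», NOT BetaPertH, NOT continuum, NOT Clay.

HONEST DEPENDENCY (page 1, mandatory): continuum YM on T⁴ ⇐ BetaPertH ∧ nine spine estimates (0/9 proved); BetaPertH ⇐ (D1) ∧ (D4) ∧ CAP+tail;
G-an2-4 gates asym, D1 and NE2/3/4.  HONEST FRAMING (cell contract, verbatim): «discharging `BetaPertH` makes Bałaban's UV stability UNCONDITIONAL —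
a real constructive-QFT result; it is NOT the continuum limit and NOT the Clay problem.»  ABSOLUTE RULE (cell charter, verbatim): «No internally-minted
statement may enter as a cited fact. Every hypothesis is either kernel-proved in this package or a verbatim quotation of a PUBLISHED theorem with page
reference. The manuscript(s) under audit are NOT citable for their own disputed steps — they are the thing under adjudication; programme-internal
(2001/route/tribunal) claims are never citable.»  Road «FP» OWNER, b2b-balaban-beta-d1-p3 gen 46, 2026-08-28.  No existing file touched.
-/

noncomputable section

open scoped BigOperators

namespace Summit.QuantumFields.BalabanUV.Beta.FP.TowerH2Letters

open Finset Matrix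
open Literature.MathematicalPhysics.QuantumFieldTheory
open Literature.MathematicalPhysics.QuantumFieldTheory.Balaban1983to89
open Literature.MathematicalPhysics.QuantumFieldTheory.Balaban1983to89.Beta
open B4TorusKernel.MultiPeriod (translate)
open B5Prop11Plancherel (fine)
open B6Lemma24Torus (pbox)
open AffineAveraging (Site)
open OneStepResolventKernel (Fib)
open WilsonBiStencil (wilsonW₂)
open BalabanStepW2 (M2Of)
open Summit.QuantumFields.BalabanUV.Beta.TameKernelCalculus (trK)
open Summit.QuantumFields.BalabanUV.Beta.BorderedHessian (sgnK)
open Summit.QuantumFields.BalabanUV.Beta.AxialDressingRooted (one_le_of_neZero)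
open Summit.QuantumFields.BalabanUV.Beta.CompositeOneShotJets (tabsComp)
open Summit.QuantumFields.BalabanUV.Beta.CompositeOneShotJetData (Roots Pins)
open Summit.QuantumFields.BalabanUV.Beta.FP.KernelPeriodisationFib (Idx perF)
open Summit.QuantumFields.BalabanUV.Beta.FP.KernelPeriodisationFibLoc (dper)
open Summit.QuantumFields.BalabanUV.Beta.FP.TorusCompositeObjects (towerTorus)
open Summit.QuantumFields.BalabanUV.Beta.GAN24.SecondOrderReadersParity (parityEven_evenHalf)
open Summit.QuantumFields.BalabanUV.Beta.FP.WoundEvenFamilyParities (parityEven_tsum perF_dper_symm_ff_of_parityEven)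

/-! ## §1 Generic algebra of the two sectors -/

section Algebra

variable {ι ι' X : Type*} [Fintype ι] [Fintype ι'] [AddCommGroup X] [Module ℝ X]

/-- [folklore] the bi-vertex form is linear in the left weight. -/
theorem sum_sum_mul_smul_linear_left (r : ℝ) (f f' g : ι → ℝ) (T : ι → ι → X) :
    ∑ b, ∑ b', ((r • f + f') b * g b') • T b b' = r • ∑ b, ∑ b', (f b * g b') • T b b' + ∑ b, ∑ b', (f' b * g b') • T b b' := by
  simp only [Pi.add_apply, Pi.smul_apply, smul_eq_mul, add_mul, add_smul, Finset.sum_add_distrib, Finset.smul_sum, smul_smul, mul_assoc]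

/-- [folklore] … and in the right weight. -/
theorem sum_sum_mul_smul_linear_right (r : ℝ) (f g g' : ι → ℝ) (T : ι → ι → X) :
    ∑ b, ∑ b', (f b * (r • g + g') b') • T b b' = r • ∑ b, ∑ b', (f b * g b') • T b b' + ∑ b, ∑ b', (f b * g' b') • T b b' := by
  simp only [Pi.add_apply, Pi.smul_apply, smul_eq_mul, mul_add, add_smul, Finset.sum_add_distrib, Finset.smul_sum, smul_smul]
  congr 1; refine Finset.sum_congr rfl fun b _ => Finset.sum_congr rfl fun b' _ => ?_; ring_nf

/-- [folklore] the symmetrically placed mixed form is linear in the first direction (`f ↦ r•f + f′`, `m ↦ r•m + m′` together). -/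
theorem sum_sum_pair_smul_linear_left (r : ℝ) (f f' g : ι → ℝ) (m m' k : ι' → ℝ) (Mx : ι → ι' → X) :
    ∑ b, ∑ β, ((r • f + f') b * k β + g b * (r • m + m') β) • Mx b β
      = r • ∑ b, ∑ β, (f b * k β + g b * m β) • Mx b β + ∑ b, ∑ β, (f' b * k β + g b * m' β) • Mx b β := by
  simp only [Finset.smul_sum, smul_smul, ← Finset.sum_add_distrib]
  refine Finset.sum_congr rfl fun b _ => Finset.sum_congr rfl fun β _ => ?_
  rw [← add_smul]; congr 1; simp only [Pi.add_apply, Pi.smul_apply, smul_eq_mul]; ring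

/-- [folklore] a bi-vertex form over a pair-symmetric table is symmetric under swapping the weights (`Finset.sum_comm`). -/
theorem sum_sum_mul_smul_comm (f g : ι → ℝ) (T : ι → ι → X) (hTs : ∀ b b', T b b' = T b' b) :
    ∑ b, ∑ b', (g b * f b') • T b b' = ∑ b, ∑ b', (f b * g b') • T b b' := by
  rw [Finset.sum_comm]
  exact Finset.sum_congr rfl fun b _ => Finset.sum_congr rfl fun b' _ => by rw [hTs b' b, mul_comm]

end Algebra

/-! ## §2 The tables: pair symmetry of `T̂₂`, matrix symmetry of `T̂₂ b b′` and `ℳ̂₂ b β` on the `ff` block -/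

section Tables

variable {Lc : ℕ} [NeZero Lc] (M : Fin (3 + 1) → ℕ) [∀ μ, NeZero (M μ)] (n : ℕ) (Pn : Pins)
  (T₂ : ↥(pbox (towerTorus Lc (fine Lc M) (n + 1))) × Fin (3 + 1) → ↥(pbox (towerTorus Lc (fine Lc M) (n + 1))) × Fin (3 + 1) → Matrix (↥(pbox (towerTorus Lc (fine Lc M) (n + 1))) × Fin (3 + 1)) (↥(pbox (towerTorus Lc (fine Lc M) (n + 1))) × Fin (3 + 1)) ℝ)
  (hT₂ : ∀ b b' : ↥(pbox (towerTorus Lc (fine Lc M) (n + 1))) × Fin (3 + 1), T₂ b b' = (1 / 2 : ℝ) • ((perF (towerTorus Lc (fine Lc M) (n + 1)) (dper (towerTorus Lc (fine Lc M) (n + 1)) (fun X Z i₁ i₂ => ∑' m : Site (3 + 1),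
              ((1 / 2 : ℝ) • (wilsonW₂ 3 (Pn.T (n + 1 + 1)) b.2 (b.1 : Site (3 + 1)) b'.2 (translate (towerTorus Lc (fine Lc M) (n + 1)) (b'.1 : Site (3 + 1)) m)
                + sgnK (trK (wilsonW₂ 3 (Pn.T (n + 1 + 1)) b.2 (b.1 : Site (3 + 1)) b'.2 (translate (towerTorus Lc (fine Lc M) (n + 1)) (b'.1 : Site (3 + 1)) m))))) X Z i₁ i₂))).submatrix
            (fun b : ↥(pbox (towerTorus Lc (fine Lc M) (n + 1))) × Fin (3 + 1) => ((b.1, Sum.inl b.2) : Idx (towerTorus Lc (fine Lc M) (n + 1)) (Fib 3)))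
            (fun b : ↥(pbox (towerTorus Lc (fine Lc M) (n + 1))) × Fin (3 + 1) => ((b.1, Sum.inl b.2) : Idx (towerTorus Lc (fine Lc M) (n + 1)) (Fib 3)))
        + (perF (towerTorus Lc (fine Lc M) (n + 1)) (dper (towerTorus Lc (fine Lc M) (n + 1)) (fun X Z i₁ i₂ => ∑' m : Site (3 + 1),
              ((1 / 2 : ℝ) • (wilsonW₂ 3 (Pn.T (n + 1 + 1)) b'.2 (b'.1 : Site (3 + 1)) b.2 (translate (towerTorus Lc (fine Lc M) (n + 1)) (b.1 : Site (3 + 1)) m)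
                + sgnK (trK (wilsonW₂ 3 (Pn.T (n + 1 + 1)) b'.2 (b'.1 : Site (3 + 1)) b.2 (translate (towerTorus Lc (fine Lc M) (n + 1)) (b.1 : Site (3 + 1)) m))))) X Z i₁ i₂))).submatrix
            (fun b : ↥(pbox (towerTorus Lc (fine Lc M) (n + 1))) × Fin (3 + 1) => ((b.1, Sum.inl b.2) : Idx (towerTorus Lc (fine Lc M) (n + 1)) (Fib 3)))
            (fun b : ↥(pbox (towerTorus Lc (fine Lc M) (n + 1))) × Fin (3 + 1) => ((b.1, Sum.inl b.2) : Idx (towerTorus Lc (fine Lc M) (n + 1)) (Fib 3)))))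
  (M₂ : ↥(pbox (towerTorus Lc (fine Lc M) (n + 1))) × Fin (3 + 1) → ↥(pbox M) × Fin (3 + 1) → Matrix (↥(pbox (towerTorus Lc (fine Lc M) (n + 1))) × Fin (3 + 1)) (↥(pbox (towerTorus Lc (fine Lc M) (n + 1))) × Fin (3 + 1)) ℝ)
  (hM₂ : ∀ (b : ↥(pbox (towerTorus Lc (fine Lc M) (n + 1))) × Fin (3 + 1)) (β : ↥(pbox M) × Fin (3 + 1)), M₂ b β = (perF (towerTorus Lc (fine Lc M) (n + 1)) (dper (towerTorus Lc (fine Lc M) (n + 1)) (fun X Z i₁ i₂ => ∑' m : Site (3 + 1),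
              ((1 / 2 : ℝ) • (M2Of 3 (Lc ^ (n + 1 + 1)) (tabsComp (n + 1 + 1) (one_le_of_neZero Lc) (Roots.ctr Lc).hr (Pn.cM (n + 1 + 1))).mixFF 0 b.2 (b.1 : Site (3 + 1)) β.2 (translate M (β.1 : Site (3 + 1)) m)
                + sgnK (trK (M2Of 3 (Lc ^ (n + 1 + 1)) (tabsComp (n + 1 + 1) (one_le_of_neZero Lc) (Roots.ctr Lc).hr (Pn.cM (n + 1 + 1))).mixFF 0 b.2 (b.1 : Site (3 + 1)) β.2 (translate M (β.1 : Site (3 + 1)) m))))) X Z i₁ i₂))).submatrix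
            (fun b : ↥(pbox (towerTorus Lc (fine Lc M) (n + 1))) × Fin (3 + 1) => ((b.1, Sum.inl b.2) : Idx (towerTorus Lc (fine Lc M) (n + 1)) (Fib 3)))
            (fun b : ↥(pbox (towerTorus Lc (fine Lc M) (n + 1))) × Fin (3 + 1) => ((b.1, Sum.inl b.2) : Idx (towerTorus Lc (fine Lc M) (n + 1)) (Fib 3))))

omit [NeZero Lc] [∀ μ, NeZero (M μ)] in
include hT₂ in
/-- [folklore] `T̂₂` is pair-symmetric: `T̂₂ b b′ = T̂₂ b′ b` (the two summands of `hT₂` exchanged). -/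
theorem T₂_pair_symm (b b' : ↥(pbox (towerTorus Lc (fine Lc M) (n + 1))) × Fin (3 + 1)) : T₂ b b' = T₂ b' b := by
  rw [hT₂, hT₂]
  exact congrArg _ (add_comm _ _)

omit [NeZero Lc] [∀ μ, NeZero (M μ)] in
include hT₂ in
/-- [folklore] each `T̂₂ b b′` is a symmetric matrix on the `ff` block (both summands are `ff` blocks of periodised graded-even kernels). -/
theorem T₂_transpose (b b' : ↥(pbox (towerTorus Lc (fine Lc M) (n + 1))) × Fin (3 + 1)) : (T₂ b b')ᵀ = T₂ b b' := by
  rw [hT₂, Matrix.transpose_smul, Matrix.transpose_add]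
  congr 2 <;>
  · ext p q
    simp only [Matrix.transpose_apply, Matrix.submatrix_apply]
    exact perF_dper_symm_ff_of_parityEven _ (parityEven_tsum _ fun m => parityEven_evenHalf _) q p

omit [∀ μ, NeZero (M μ)] in
include hM₂ in
/-- [folklore] each `ℳ̂₂ b β` is a symmetric matrix on the `ff` block. -/
theorem M₂_transpose (b : ↥(pbox (towerTorus Lc (fine Lc M) (n + 1))) × Fin (3 + 1)) (β : ↥(pbox M) × Fin (3 + 1)) : (M₂ b β)ᵀ = M₂ b β := by
  rw [hM₂]
  ext p q
  simp only [Matrix.transpose_apply, Matrix.submatrix_apply]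
  exact perF_dper_symm_ff_of_parityEven _ (parityEven_tsum _ fun m => parityEven_evenHalf _) q p

end Tables

/-! ## §3 The pin `hH₂f` and v5's three shape letters + PART 2's symmetrised display -/

section Pin

variable {Lc : ℕ} [NeZero Lc] (M : Fin (3 + 1) → ℕ) [∀ μ, NeZero (M μ)] (n : ℕ) (c : ℝ) (Pn : Pins) {κ : Type*}
  (hv : (κ → ℝ) → (↥(pbox (towerTorus Lc (fine Lc M) (n + 1))) × Fin (3 + 1) → ℝ))
  (hhvl : ∀ (r : ℝ) (x y : κ → ℝ), hv (r • x + y) = r • hv x + hv y)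
  (T₂ : ↥(pbox (towerTorus Lc (fine Lc M) (n + 1))) × Fin (3 + 1) → ↥(pbox (towerTorus Lc (fine Lc M) (n + 1))) × Fin (3 + 1) → Matrix (↥(pbox (towerTorus Lc (fine Lc M) (n + 1))) × Fin (3 + 1)) (↥(pbox (towerTorus Lc (fine Lc M) (n + 1))) × Fin (3 + 1)) ℝ)
  (hT₂ : ∀ b b' : ↥(pbox (towerTorus Lc (fine Lc M) (n + 1))) × Fin (3 + 1), T₂ b b' = (1 / 2 : ℝ) • ((perF (towerTorus Lc (fine Lc M) (n + 1)) (dper (towerTorus Lc (fine Lc M) (n + 1)) (fun X Z i₁ i₂ => ∑' m : Site (3 + 1),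
              ((1 / 2 : ℝ) • (wilsonW₂ 3 (Pn.T (n + 1 + 1)) b.2 (b.1 : Site (3 + 1)) b'.2 (translate (towerTorus Lc (fine Lc M) (n + 1)) (b'.1 : Site (3 + 1)) m)
                + sgnK (trK (wilsonW₂ 3 (Pn.T (n + 1 + 1)) b.2 (b.1 : Site (3 + 1)) b'.2 (translate (towerTorus Lc (fine Lc M) (n + 1)) (b'.1 : Site (3 + 1)) m))))) X Z i₁ i₂))).submatrix
            (fun b : ↥(pbox (towerTorus Lc (fine Lc M) (n + 1))) × Fin (3 + 1) => ((b.1, Sum.inl b.2) : Idx (towerTorus Lc (fine Lc M) (n + 1)) (Fib 3)))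
            (fun b : ↥(pbox (towerTorus Lc (fine Lc M) (n + 1))) × Fin (3 + 1) => ((b.1, Sum.inl b.2) : Idx (towerTorus Lc (fine Lc M) (n + 1)) (Fib 3)))
        + (perF (towerTorus Lc (fine Lc M) (n + 1)) (dper (towerTorus Lc (fine Lc M) (n + 1)) (fun X Z i₁ i₂ => ∑' m : Site (3 + 1),
              ((1 / 2 : ℝ) • (wilsonW₂ 3 (Pn.T (n + 1 + 1)) b'.2 (b'.1 : Site (3 + 1)) b.2 (translate (towerTorus Lc (fine Lc M) (n + 1)) (b.1 : Site (3 + 1)) m)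
                + sgnK (trK (wilsonW₂ 3 (Pn.T (n + 1 + 1)) b'.2 (b'.1 : Site (3 + 1)) b.2 (translate (towerTorus Lc (fine Lc M) (n + 1)) (b.1 : Site (3 + 1)) m))))) X Z i₁ i₂))).submatrix
            (fun b : ↥(pbox (towerTorus Lc (fine Lc M) (n + 1))) × Fin (3 + 1) => ((b.1, Sum.inl b.2) : Idx (towerTorus Lc (fine Lc M) (n + 1)) (Fib 3)))
            (fun b : ↥(pbox (towerTorus Lc (fine Lc M) (n + 1))) × Fin (3 + 1) => ((b.1, Sum.inl b.2) : Idx (towerTorus Lc (fine Lc M) (n + 1)) (Fib 3)))))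
  (hm : (κ → ℝ) → (↥(pbox M) × Fin (3 + 1) → ℝ))
  (hml : ∀ (r : ℝ) (x y : κ → ℝ), hm (r • x + y) = r • hm x + hm y)
  (M₂ : ↥(pbox (towerTorus Lc (fine Lc M) (n + 1))) × Fin (3 + 1) → ↥(pbox M) × Fin (3 + 1) → Matrix (↥(pbox (towerTorus Lc (fine Lc M) (n + 1))) × Fin (3 + 1)) (↥(pbox (towerTorus Lc (fine Lc M) (n + 1))) × Fin (3 + 1)) ℝ)
  (hM₂ : ∀ (b : ↥(pbox (towerTorus Lc (fine Lc M) (n + 1))) × Fin (3 + 1)) (β : ↥(pbox M) × Fin (3 + 1)), M₂ b β = (perF (towerTorus Lc (fine Lc M) (n + 1)) (dper (towerTorus Lc (fine Lc M) (n + 1)) (fun X Z i₁ i₂ => ∑' m : Site (3 + 1),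
              ((1 / 2 : ℝ) • (M2Of 3 (Lc ^ (n + 1 + 1)) (tabsComp (n + 1 + 1) (one_le_of_neZero Lc) (Roots.ctr Lc).hr (Pn.cM (n + 1 + 1))).mixFF 0 b.2 (b.1 : Site (3 + 1)) β.2 (translate M (β.1 : Site (3 + 1)) m)
                + sgnK (trK (M2Of 3 (Lc ^ (n + 1 + 1)) (tabsComp (n + 1 + 1) (one_le_of_neZero Lc) (Roots.ctr Lc).hr (Pn.cM (n + 1 + 1))).mixFF 0 b.2 (b.1 : Site (3 + 1)) β.2 (translate M (β.1 : Site (3 + 1)) m))))) X Z i₁ i₂))).submatrix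
            (fun b : ↥(pbox (towerTorus Lc (fine Lc M) (n + 1))) × Fin (3 + 1) => ((b.1, Sum.inl b.2) : Idx (towerTorus Lc (fine Lc M) (n + 1)) (Fib 3)))
            (fun b : ↥(pbox (towerTorus Lc (fine Lc M) (n + 1))) × Fin (3 + 1) => ((b.1, Sum.inl b.2) : Idx (towerTorus Lc (fine Lc M) (n + 1)) (Fib 3))))
  (cM₂ : ℝ)
  -- THE v6 PIN of the second H-jet (SPEC-57 §4 (i)): Wilson bi-sector over `T̂₂` + mixed sector over `hm ∕ ℳ̂₂`
  (H₂f : (κ → ℝ) → (κ → ℝ) → Matrix (↥(pbox (towerTorus Lc (fine Lc M) (n + 1))) × Fin (3 + 1)) (↥(pbox (towerTorus Lc (fine Lc M) (n + 1))) × Fin (3 + 1)) ℝ)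
  (hH₂f : ∀ v v', H₂f v v' = (-2 * c) ^ 2 • ∑ b : ↥(pbox (towerTorus Lc (fine Lc M) (n + 1))) × Fin (3 + 1), ∑ b' : ↥(pbox (towerTorus Lc (fine Lc M) (n + 1))) × Fin (3 + 1), (hv v b * hv v' b') • T₂ b b'
      + cM₂ • ∑ b : ↥(pbox (towerTorus Lc (fine Lc M) (n + 1))) × Fin (3 + 1), ∑ β : ↥(pbox M) × Fin (3 + 1), (hv v b * hm v' β + hv v' b * hm v β) • M₂ b β)

omit [NeZero Lc] [∀ μ, NeZero (M μ)] in
include hT₂ hH₂f in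
/-- [folklore] **`H2f_symm`** — the pinned second H-jet is symmetric in its two directions (`T̂₂` pair-symmetric; the mixed sector symmetrically placed). -/
theorem H2f_symm (v v' : κ → ℝ) : H₂f v v' = H₂f v' v := by
  rw [hH₂f, hH₂f, sum_sum_mul_smul_comm (hv v) (hv v') T₂ (T₂_pair_symm M n Pn T₂ hT₂)]
  congr 1
  exact congrArg _ (Finset.sum_congr rfl fun b _ => Finset.sum_congr rfl fun β _ => by rw [add_comm (hv v b * hm v' β)])

omit [NeZero Lc] [∀ μ, NeZero (M μ)] in
include hT₂ hH₂f in
/-- [folklore] **`H2f_half_symm_eq` — PART 2's ∕ 3b's display `hH₂`** at `Λ₂ v v′ := cM₂ • ΣΣ (hv v b·hm v′ β + hv v′ b·hm v β) • ℳ̂₂ b β`: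
`½•(H₂f v v′ + H₂f v′ v) = (−2c)²•ΣΣ (hv v b·hv v′ b′)•T̂₂ b b′ + Λ₂ v v′`. -/
theorem H2f_half_symm_eq (v v' : κ → ℝ) :
    (1 / 2 : ℝ) • (H₂f v v' + H₂f v' v)
      = (-2 * c) ^ 2 • ∑ b : ↥(pbox (towerTorus Lc (fine Lc M) (n + 1))) × Fin (3 + 1), ∑ b' : ↥(pbox (towerTorus Lc (fine Lc M) (n + 1))) × Fin (3 + 1), (hv v b * hv v' b') • T₂ b b'
        + cM₂ • ∑ b : ↥(pbox (towerTorus Lc (fine Lc M) (n + 1))) × Fin (3 + 1), ∑ β : ↥(pbox M) × Fin (3 + 1), (hv v b * hm v' β + hv v' b * hm v β) • M₂ b β := by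
  rw [← H2f_symm M n c Pn hv T₂ hT₂ hm M₂ cM₂ H₂f hH₂f v v', ← two_smul ℝ (H₂f v v'), smul_smul, show (1 / 2 : ℝ) * 2 = 1 by norm_num, one_smul]
  exact hH₂f v v'

omit [NeZero Lc] [∀ μ, NeZero (M μ)] in
include hhvl hml hH₂f in
/-- [folklore] **`H2f_linear_left` — v5's `hH₂l`.** -/
theorem H2f_linear_left (r : ℝ) (x y z : κ → ℝ) : H₂f (r • x + y) z = r • H₂f x z + H₂f y z := by
  rw [hH₂f, hH₂f, hH₂f, hhvl, hml, sum_sum_mul_smul_linear_left, sum_sum_pair_smul_linear_left]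
  module

omit [NeZero Lc] [∀ μ, NeZero (M μ)] in
include hhvl hml hH₂f in
/-- [folklore] **`H2f_linear_right` — v5's `hH₂r`.** -/
theorem H2f_linear_right (r : ℝ) (x y z : κ → ℝ) : H₂f z (r • x + y) = r • H₂f z x + H₂f z y := by
  rw [hH₂f, hH₂f, hH₂f, hhvl, hml, sum_sum_mul_smul_linear_right]
  have h : ∑ b : ↥(pbox (towerTorus Lc (fine Lc M) (n + 1))) × Fin (3 + 1), ∑ β : ↥(pbox M) × Fin (3 + 1), (hv z b * (r • hm x + hm y) β + (r • hv x + hv y) b * hm z β) • M₂ b β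
      = r • ∑ b : ↥(pbox (towerTorus Lc (fine Lc M) (n + 1))) × Fin (3 + 1), ∑ β : ↥(pbox M) × Fin (3 + 1), (hv z b * hm x β + hv x b * hm z β) • M₂ b β
        + ∑ b : ↥(pbox (towerTorus Lc (fine Lc M) (n + 1))) × Fin (3 + 1), ∑ β : ↥(pbox M) × Fin (3 + 1), (hv z b * hm y β + hv y b * hm z β) • M₂ b β := by
    simp only [Finset.smul_sum, smul_smul, ← Finset.sum_add_distrib]
    refine Finset.sum_congr rfl fun b _ => Finset.sum_congr rfl fun β _ => ?_
    rw [← add_smul]; congr 1; simp only [Pi.add_apply, Pi.smul_apply, smul_eq_mul]; ring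
  rw [h]
  module

omit [∀ μ, NeZero (M μ)] in
include hT₂ hM₂ hH₂f in
/-- [folklore] **`H2f_transpose` — v5's `hH₂t`**: `(H₂f v v)ᵀ = H₂f v v` (termwise `T₂_transpose ∕ M₂_transpose`). -/
theorem H2f_transpose (v : κ → ℝ) : (H₂f v v)ᵀ = H₂f v v := by
  rw [hH₂f]
  simp only [Matrix.transpose_add, Matrix.transpose_smul, Matrix.transpose_sum, T₂_transpose M n Pn T₂ hT₂, M₂_transpose M n Pn M₂ hM₂]

end Pin

end Summit.QuantumFields.BalabanUV.Beta.FP.TowerH2Letters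

end
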